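import Mathlib
import HarnessLib
import Summits.HubbardSuperconductivity.HubbardSuperconductivity.Theorems.KLProgrammeKLRegimeVolumeLimitSixPointWordIntegral
import Summits.HubbardSuperconductivity.HubbardSuperconductivity.Theorems.KLProgrammeKLRegimeVolumeLimitBoundDoor

/-!
# Child `KLRegimeVolumeLimitV12` (stmt-HubbardSuperconductivity-19858), stub `stub_vl_bound` — the LIMIT GLUE: the bare-frame, spin-`↑`
# uniform bound (hence, by `…VolumeLimitBoundDoor`, the registered stub verbatim) from the six-point Matsubara bridge stated as two
# ABSTRACT limit hypotheses (seat hubbard-kl-k3c5-p3, technique «OS-positivity-free direct assembly»)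

Fix `β > 0`, `U`, `μ`.  At every `L ≥ 3` suppose the six-point bridge (TAU-BRIDGE.md §6 (Z), HOME/hubbard-kl-k3c5-p2; k3c5-p1's `sixPointWord`
interface, `…VolumeLimitSixPointDefs`) in the following abstract form:
* (Z1, fixed `L`) a limit `Sinf z : ℝ → ℂ` (interval-integrable on `[0, β]`) of the word six-point function IN `L¹(du)` for every torus site,
  `∫₀^β ‖∫dμ_{C_M}e^{−V}·sixPointWord L M β 0 1 z u − Sinf z u‖ du → 0`, and a non-zero limit `Dinf` of the bare normalised partition functions;
* (Z2, uniform in `L`) `‖∫₀^β Σ_z e^{−iω_n u} conj χ_p(z) Sinf z u du‖ ≤ Binf·‖Dinf‖` for every Matsubara integer `n` and torus momentum `p`.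
Then (`bareFrameBound_of_sixPointBridge`) for every `L ≥ 3` eventually in `M`, for EVERY label `k`,
`‖klSelfEnergy L M β U μ 0 klE0 (nScales β + 1) k 0‖ ≤ 2|U| + U²(2Binf + 1)`: the order-`U` half is `…VolumeLimitOccupation`, the `U²` half is the
time-integral Fourier form `sixPoint_up_eq_integral_word` + (Z1) (label-UNIFORM because the phases have modulus one) + (Z2); thresholds are
packed into a function `Mth` (`exists_thresholdFn`) and `stub_vl_bound_of_sixPointBridge` feeds the door.  Everything is proved; no definition.
-/

noncomputable section

namespace Summit.HubbardSuperconductivity.HubbardSuperconductivity.Theorems.TwoPointAssembly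

set_option linter.dupNamespace false -- summit = problem name (single-conjunct summit), D-0017

open Finset Filter Topology MeasureTheory intervalIntegral Literature.MathematicalPhysics.QuantumLattice Literature.Probability.LatticeModels
  GrassmannAlgebra
open Summit.HubbardSuperconductivity.HubbardSuperconductivity.Theorems.KLRegimeSplit
open Summit.HubbardSuperconductivity.HubbardSuperconductivity.Theorems.KLProgrammeLegKernels
open scoped ComplexConjugate

variable {L M : ℕ} [NeZero L]

/-! ## §1 Continuity in the time of the word six-point function at finite cutoff -/

/-- The word six-point function `u ↦ ∫dμ_C e^{−V}·sixPointWord L M β 0 1 z u` is continuous (a trigonometric polynomial in `u`). -/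
theorem continuous_wordSixPoint_up (β U μ : ℝ) (z : TorusSite 2 L) :
    Continuous fun u : ℝ =>
      gaussExpect ℂ (hubbardCovariance L M β μ 0) (grassmannExp (-(hubbardInteraction L M β U)) * sixPointWord L M β 0 1 z u) := by
  simp_rw [wordSixPoint_up_eq_sum]
  refine continuous_finsetSum _ fun q _ => continuous_finsetSum _ fun p _ => ?_
  have h0 := continuous_conj_vertexPlaneWave_time (L := L) (M := M) β 0 q.1 z
  have h1 := continuous_conj_vertexPlaneWave_time (L := L) (M := M) β 0 q.2.1 z
  have h2 := continuous_conj_vertexPlaneWave_time (L := L) (M := M) β 1 q.2.2 z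
  exact (((continuous_const.mul h0).mul ((continuous_const.mul h1).mul (continuous_const.mul h2))).mul continuous_const).mul
    continuous_const

/-! ## §2 Packing per-volume thresholds into a threshold function -/

/-- From «for every `L ≥ L₀` there is a Matsubara threshold» to ONE threshold function `Mth`. -/
theorem exists_thresholdFn {L₀ : ℕ} {P : (L : ℕ) → (M : ℕ) → Prop}
    (h : ∀ L : ℕ, L₀ ≤ L → ∃ M₁ : ℕ, ∀ M : ℕ, M₁ ≤ M → P L M) :
    ∃ Mth : ℕ → ℕ, ∀ L : ℕ, L₀ ≤ L → ∀ M : ℕ, Mth L ≤ M → P L M := by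
  classical
  refine ⟨fun L => if hL : L₀ ≤ L then Classical.choose (h L hL) else 0, fun L hL M hM => ?_⟩
  simp only [dif_pos hL] at hM
  exact Classical.choose_spec (h L hL) M hM

/-! ## §3 The bare-frame bound from the six-point bridge -/

/-- **THE LIMIT GLUE, at one volume `L ≥ 3`.**  (Z1) at `L` + (Z2) ⟹ eventually in `M`, for every label `k`,
`‖Σ̂⁰_{L,M}(k,↑)‖ ≤ 2|U| + U²(2Binf + 1)`. -/
theorem eventually_norm_klSelfEnergy_bare_le_of_bridge (hL : 3 ≤ L) {β : ℝ} (hβ : 0 < β) (U μ : ℝ) {Binf : ℝ} (hB : 0 ≤ Binf)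
    (Sinf : TorusSite 2 L → ℝ → ℂ) (hSi : ∀ z, IntervalIntegrable (Sinf z) volume 0 β) (Dinf : ℂ) (hDinf : Dinf ≠ 0)
    (hD : Tendsto (fun M : ℕ => effPartitionFn ℂ (hubbardCovariance L M β μ 0) (hubbardInteraction L M β U)) atTop (𝓝 Dinf))
    (hS : ∀ z : TorusSite 2 L, Tendsto (fun M : ℕ => ∫ u in (0 : ℝ)..β,
        ‖gaussExpect ℂ (hubbardCovariance L M β μ 0) (grassmannExp (-(hubbardInteraction L M β U)) * sixPointWord L M β 0 1 z u) -
          Sinf z u‖) atTop (𝓝 0))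
    (hZ2 : ∀ (n : ℤ) (p : TorusSite 2 L), ‖∫ u in (0 : ℝ)..β, ∑ z : TorusSite 2 L,
        Complex.exp (-(((Real.pi * (2 * (n : ℝ) + 1) / β * u : ℝ) : ℂ) * Complex.I)) * conj (torusChar p z) * Sinf z u‖ ≤ Binf * ‖Dinf‖) :
    ∀ᶠ M : ℕ in atTop, ∀ k : FreqMomentum L M,
      ‖klSelfEnergy L M β U μ 0 klE0 (nScales β + 1) k 0‖ ≤ 2 * |U| + U ^ 2 * (2 * Binf + 1) := by
  have hDpos : 0 < ‖Dinf‖ := norm_pos_iff.mpr hDinf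
  -- (a) the partition function stays away from zero
  have hDev : ∀ᶠ M : ℕ in atTop, ‖Dinf‖ / 2 ≤ ‖effPartitionFn ℂ (hubbardCovariance L M β μ 0) (hubbardInteraction L M β U)‖ := by
    have h := hD.eventually (Metric.ball_mem_nhds Dinf (half_pos hDpos))
    filter_upwards [h] with M hM
    rw [dist_eq_norm] at hM
    have := norm_sub_norm_le Dinf (effPartitionFn ℂ (hubbardCovariance L M β μ 0) (hubbardInteraction L M β U))
    rw [← norm_neg, neg_sub] at hM
    linarith
  -- (b) the L¹ distances, summed over the torus, go to zero
  have hSsum : Tendsto (fun M : ℕ => ∑ z : TorusSite 2 L, ∫ u in (0 : ℝ)..β,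
      ‖gaussExpect ℂ (hubbardCovariance L M β μ 0) (grassmannExp (-(hubbardInteraction L M β U)) * sixPointWord L M β 0 1 z u) -
        Sinf z u‖) atTop (𝓝 0) := by
    have := tendsto_finsetSum (Finset.univ : Finset (TorusSite 2 L)) fun z _ => hS z
    simpa using this
  have hSev : ∀ᶠ M : ℕ in atTop, ∑ z : TorusSite 2 L, ∫ u in (0 : ℝ)..β,
      ‖gaussExpect ℂ (hubbardCovariance L M β μ 0) (grassmannExp (-(hubbardInteraction L M β U)) * sixPointWord L M β 0 1 z u) -
        Sinf z u‖ < ‖Dinf‖ / 4 :=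
    hSsum.eventually (gt_mem_nhds (by positivity))
  -- (c) the order-U half
  have hOcc := norm_klSelfEnergy_bare_sub_sixPoint_le_eventually (L := L) hL hβ U μ
  filter_upwards [hDev, hSev, hOcc] with M hDM hSM hOM k
  set D : ℂ := effPartitionFn ℂ (hubbardCovariance L M β μ 0) (hubbardInteraction L M β U) with hDdef
  have hDne : D ≠ 0 := by
    intro h; rw [h, norm_zero] at hDM; linarith
  have hDnorm : 0 < ‖D‖ := norm_pos_iff.mpr hDne
  -- the Fourier form of the U² half at this label
  set SM : TorusSite 2 L → ℝ → ℂ := fun z u =>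
    gaussExpect ℂ (hubbardCovariance L M β μ 0) (grassmannExp (-(hubbardInteraction L M β U)) * sixPointWord L M β 0 1 z u) with hSM_def
  set φ : TorusSite 2 L → ℝ → ℂ := fun z u =>
    Complex.exp (-(((matsubaraFreq β M k.1 * u : ℝ) : ℂ) * Complex.I)) * conj (torusChar k.2 z) with hφ
  have hφnorm : ∀ z u, ‖φ z u‖ = 1 := fun z u => by
    rw [hφ]; dsimp only
    rw [norm_mul, ← neg_mul, ← Complex.ofReal_neg, Complex.norm_exp_ofReal_mul_I, Complex.norm_conj, norm_torusChar, one_mul]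
  have hI : ((β * (L : ℝ) ^ 2 : ℝ) : ℂ) *
      gaussExpect ℂ (hubbardCovariance L M β μ 0)
        (grassmannExp (-(hubbardInteraction L M β U)) *
          (grassmannDeriv ℂ (((k, 0), 0) : HubbardFieldIdx L M) (hubbardInteraction L M β 1) *
            grassmannDeriv ℂ (((k, 0), 1) : HubbardFieldIdx L M) (hubbardInteraction L M β 1))) =
      ∫ u in (0 : ℝ)..β, ∑ z : TorusSite 2 L, φ z u * SM z u := sixPoint_up_eq_integral_word hβ.ne' U μ k
  -- continuity / integrability
  have hSMc : ∀ z, Continuous (SM z) := fun z => continuous_wordSixPoint_up (L := L) (M := M) β U μ z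
  have hφc : ∀ z, Continuous (φ z) := fun z => by rw [hφ]; fun_prop
  -- (d) the label-uniform comparison with the limit transform
  set Iinf : ℂ := ∫ u in (0 : ℝ)..β, ∑ z : TorusSite 2 L, φ z u * Sinf z u with hIinf
  have hdiff : ‖(∫ u in (0 : ℝ)..β, ∑ z : TorusSite 2 L, φ z u * SM z u) - Iinf‖ ≤ ‖Dinf‖ / 4 := by
    have hint1 : IntervalIntegrable (fun u => ∑ z : TorusSite 2 L, φ z u * SM z u) volume 0 β :=
      (continuous_finsetSum _ fun z _ => (hφc z).mul (hSMc z)).intervalIntegrable _ _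
    have hint2 : IntervalIntegrable (fun u => ∑ z : TorusSite 2 L, φ z u * Sinf z u) volume 0 β := by
      have h := IntervalIntegrable.sum (Finset.univ : Finset (TorusSite 2 L)) fun z _ => ((hSi z).continuousOn_mul (hφc z).continuousOn)
      simpa only [Finset.sum_fn] using h
    rw [hIinf, ← intervalIntegral.integral_sub hint1 hint2]
    have hg : IntervalIntegrable (fun u => ∑ z : TorusSite 2 L, ‖SM z u - Sinf z u‖) volume 0 β := by
      have h := IntervalIntegrable.sum (Finset.univ : Finset (TorusSite 2 L)) fun z _ =>
        (((hSMc z).intervalIntegrable (0 : ℝ) β).sub (hSi z)).norm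
      simpa only [Finset.sum_fn] using h
    refine (intervalIntegral.norm_integral_le_of_norm_le hβ.le (Filter.Eventually.of_forall fun u _ => ?_) hg).trans ?_
    · rw [← Finset.sum_sub_distrib]
      refine (norm_sum_le _ _).trans (Finset.sum_le_sum fun z _ => ?_)
      rw [← mul_sub, norm_mul, hφnorm, one_mul]
    · rw [intervalIntegral.integral_finsetSum fun z _ => (((hSMc z).intervalIntegrable _ _).sub (hSi z)).norm]
      exact hSM.le
  -- (e) the limit transform is bounded, uniformly in the label (Z2 at the integer label of `k`)
  have hIinfle : ‖Iinf‖ ≤ Binf * ‖Dinf‖ := by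
    have h := hZ2 (matsubaraInt M k.1) k.2
    rw [hIinf, hφ]
    simpa only [matsubaraFreq] using h
  -- (f) assemble
  have hU2 : ‖(U : ℂ) ^ 2 * ((β * (L : ℝ) ^ 2 : ℝ) : ℂ) *
      gaussExpect ℂ (hubbardCovariance L M β μ 0)
        (grassmannExp (-(hubbardInteraction L M β U)) *
          (grassmannDeriv ℂ (((k, 0), 0) : HubbardFieldIdx L M) (hubbardInteraction L M β 1) *
            grassmannDeriv ℂ (((k, 0), 1) : HubbardFieldIdx L M) (hubbardInteraction L M β 1))) / D‖ ≤
      U ^ 2 * (2 * Binf + 1) := by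
    rw [mul_assoc, hI, norm_div, norm_mul, norm_pow, Complex.norm_real, Real.norm_eq_abs, sq_abs, div_le_iff₀ hDnorm]
    have hIM : ‖∫ u in (0 : ℝ)..β, ∑ z : TorusSite 2 L, φ z u * SM z u‖ ≤ Binf * ‖Dinf‖ + ‖Dinf‖ / 4 := by
      have := norm_sub_norm_le (∫ u in (0 : ℝ)..β, ∑ z : TorusSite 2 L, φ z u * SM z u) Iinf
      linarith
    calc U ^ 2 * ‖∫ u in (0 : ℝ)..β, ∑ z : TorusSite 2 L, φ z u * SM z u‖ ≤ U ^ 2 * (Binf * ‖Dinf‖ + ‖Dinf‖ / 4) :=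
          mul_le_mul_of_nonneg_left hIM (sq_nonneg U)
      _ ≤ U ^ 2 * (2 * Binf + 1) * ‖D‖ := by nlinarith [sq_nonneg U, mul_nonneg (sq_nonneg U) hB]
  have hO := hOM hDne k 0
  calc ‖klSelfEnergy L M β U μ 0 klE0 (nScales β + 1) k 0‖
      ≤ ‖klSelfEnergy L M β U μ 0 klE0 (nScales β + 1) k 0 -
            (U : ℂ) ^ 2 * ((β * (L : ℝ) ^ 2 : ℝ) : ℂ) *
              gaussExpect ℂ (hubbardCovariance L M β μ 0)
                (grassmannExp (-(hubbardInteraction L M β U)) *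
                  (grassmannDeriv ℂ (((k, 0), 0) : HubbardFieldIdx L M) (hubbardInteraction L M β 1) *
                    grassmannDeriv ℂ (((k, 0), 1) : HubbardFieldIdx L M) (hubbardInteraction L M β 1))) / D‖ +
          ‖(U : ℂ) ^ 2 * ((β * (L : ℝ) ^ 2 : ℝ) : ℂ) *
              gaussExpect ℂ (hubbardCovariance L M β μ 0)
                (grassmannExp (-(hubbardInteraction L M β U)) *
                  (grassmannDeriv ℂ (((k, 0), 0) : HubbardFieldIdx L M) (hubbardInteraction L M β 1) *
                    grassmannDeriv ℂ (((k, 0), 1) : HubbardFieldIdx L M) (hubbardInteraction L M β 1))) / D‖ :=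
        norm_le_norm_sub_add _ _
    _ ≤ 2 * |U| + U ^ 2 * (2 * Binf + 1) := add_le_add hO hU2

/-- **THE BARE-FRAME BOUND FROM THE SIX-POINT BRIDGE** (`β > 0`, any `U`, `μ`): (Z1) at every `L ≥ 3` and (Z2) uniformly in `L` give
`∃ B₀ L₀ Mth, ∀ L ≥ L₀, ∀ M ≥ Mth L, ∀ k, ‖klSelfEnergy L M β U μ 0 klE0 (nScales β + 1) k 0‖ ≤ B₀` — the hypothesis of the door
`stub_vl_bound_of_bareFrameBound`. -/
theorem bareFrameBound_of_sixPointBridge {β : ℝ} (hβ : 0 < β) (U μ : ℝ) {Binf : ℝ} (hB : 0 ≤ Binf)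
    (hZ : ∀ (L : ℕ) [NeZero L], 3 ≤ L →
      ∃ (Sinf : TorusSite 2 L → ℝ → ℂ) (Dinf : ℂ), Dinf ≠ 0 ∧ (∀ z, IntervalIntegrable (Sinf z) volume 0 β) ∧
        Tendsto (fun M : ℕ => effPartitionFn ℂ (hubbardCovariance L M β μ 0) (hubbardInteraction L M β U)) atTop (𝓝 Dinf) ∧
        (∀ z : TorusSite 2 L, Tendsto (fun M : ℕ => ∫ u in (0 : ℝ)..β,
          ‖gaussExpect ℂ (hubbardCovariance L M β μ 0) (grassmannExp (-(hubbardInteraction L M β U)) * sixPointWord L M β 0 1 z u) -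
            Sinf z u‖) atTop (𝓝 0)) ∧
        (∀ (n : ℤ) (p : TorusSite 2 L), ‖∫ u in (0 : ℝ)..β, ∑ z : TorusSite 2 L,
          Complex.exp (-(((Real.pi * (2 * (n : ℝ) + 1) / β * u : ℝ) : ℂ) * Complex.I)) * conj (torusChar p z) * Sinf z u‖ ≤
            Binf * ‖Dinf‖)) :
    ∃ B₀ : ℝ, ∃ L₀ : ℕ, ∃ Mth : ℕ → ℕ, ∀ (L : ℕ) [NeZero L], L₀ ≤ L → ∀ (M : ℕ) [NeZero M], Mth L ≤ M →
      ∀ k : FreqMomentum L M, ‖klSelfEnergy L M β U μ 0 klE0 (nScales β + 1) k 0‖ ≤ B₀ := by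
  -- per-volume thresholds (stated without the instance, recovered inside)
  have hper : ∀ L : ℕ, 3 ≤ L → ∃ M₁ : ℕ, ∀ M : ℕ, M₁ ≤ M → ∀ (hL0 : NeZero L) (k : FreqMomentum L M),
      ‖klSelfEnergy L M β U μ 0 klE0 (nScales β + 1) k 0‖ ≤ 2 * |U| + U ^ 2 * (2 * Binf + 1) := by
    intro L hL
    haveI : NeZero L := ⟨by omega⟩
    obtain ⟨Sinf, Dinf, hDinf, hSi, hD, hS, hZ2⟩ := hZ L hL
    have hev := eventually_norm_klSelfEnergy_bare_le_of_bridge hL hβ U μ hB Sinf hSi Dinf hDinf hD hS hZ2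
    obtain ⟨M₁, hM₁⟩ := Filter.eventually_atTop.mp hev
    exact ⟨M₁, fun M hM _ k => hM₁ M hM k⟩
  obtain ⟨Mth, hMth⟩ := exists_thresholdFn hper
  exact ⟨2 * |U| + U ^ 2 * (2 * Binf + 1), 3, Mth, fun L _ hL M _ hM k => hMth L hL M hM inferInstance k⟩

/-- **`stub_vl_bound` FROM THE SIX-POINT BRIDGE**: (Z1) + (Z2) for every `β > 0`, `U`, `μ` (with a bound `Binf β U μ`) give the registered stub
text verbatim (via `stub_vl_bound_of_bareFrameBound`). -/
theorem stub_vl_bound_of_sixPointBridge (Binf : ℝ → ℝ → ℝ → ℝ) (hB : ∀ β U μ, 0 ≤ Binf β U μ)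
    (hZ : ∀ β : ℝ, 0 < β → ∀ (U μ : ℝ) (L : ℕ) [NeZero L], 3 ≤ L →
      ∃ (Sinf : TorusSite 2 L → ℝ → ℂ) (Dinf : ℂ), Dinf ≠ 0 ∧ (∀ z, IntervalIntegrable (Sinf z) volume 0 β) ∧
        Tendsto (fun M : ℕ => effPartitionFn ℂ (hubbardCovariance L M β μ 0) (hubbardInteraction L M β U)) atTop (𝓝 Dinf) ∧
        (∀ z : TorusSite 2 L, Tendsto (fun M : ℕ => ∫ u in (0 : ℝ)..β,
          ‖gaussExpect ℂ (hubbardCovariance L M β μ 0) (grassmannExp (-(hubbardInteraction L M β U)) * sixPointWord L M β 0 1 z u) -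
            Sinf z u‖) atTop (𝓝 0)) ∧
        (∀ (n : ℤ) (p : TorusSite 2 L), ‖∫ u in (0 : ℝ)..β, ∑ z : TorusSite 2 L,
          Complex.exp (-(((Real.pi * (2 * (n : ℝ) + 1) / β * u : ℝ) : ℂ) * Complex.I)) * conj (torusChar p z) * Sinf z u‖ ≤
            Binf β U μ * ‖Dinf‖)) :
    ∀ (G : GeoConsts) (P : SplitConsts) (Q : EngConsts) (R : RenConsts), G.WF → P.WF → Q.WF → R.WF →
      ∃ c₅ : ℝ, 0 < c₅ ∧ ∀ c : ℝ, 0 < c → c ≤ c₅ → ∃ U₀ : ℝ, 0 < U₀ ∧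
        ∀ μ ∈ klWindowC, ∀ U : ℝ, 0 < U → U ≤ U₀ → ∀ β : ℝ, klBetaMin ≤ β → β ≤ Real.exp (c / U ^ 2) →
          ∀ K : TrigPolyC4v, klPredsV12.frameOK R U (nScales β) μ K →
            ∀ (Lstar : ℕ) (Mstar : ℕ → ℕ), TowerP klPredsV12 G P Q R β U μ K Lstar Mstar →
              ∃ B : ℝ, ∃ L₀ : ℕ, ∃ Mth : ℕ → ℕ, ∀ (L : ℕ) [NeZero L], L₀ ≤ L → ∀ (M : ℕ) [NeZero M], Mth L ≤ M →
                ∀ (k : FreqMomentum L M) (σ : Fin 2), ‖klSelfEnergy L M β U μ K klE0 (nScales β + 1) k σ‖ ≤ B :=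
  stub_vl_bound_of_bareFrameBound fun β hβ U μ =>
    let ⟨B₀, L₀, Mth, h⟩ := bareFrameBound_of_sixPointBridge hβ U μ (hB β U μ) (fun L _ hL => hZ β hβ U μ L hL)
    ⟨B₀, L₀, Mth, h⟩

end Summit.HubbardSuperconductivity.HubbardSuperconductivity.Theorems.TwoPointAssembly

end
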